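/-
Copyright (c) 2026 the pub-hodgecm-mathlib formalisation cell (harness21).  Prover seat hodgecm-mathlib-LH4-p08 (g3), req620 Track A «(D-RAM) FOUR-FRAME» squad
(unit U3_Laws, κ-STAGE B brick κB-H «CORE-HANGING κ-SOCKETS», dealer LH4-plan (g11) WORD #42 (2)∕#43 (2); holder LH4-p06 (g3) (letter `LETTER-kappaBH-tv0.v1.LH4p06g3.md`
da173de2, files κH-A1∕A2∕B1); THIS FILE = κH-B2 «THE SOCKET ASSEMBLY» (tv = 0), typed by LH4-p08 (g3) as p06's second hands; interface letter `LETTER-kappaBH-B1B2-interface.v1.LH4p06g3.md` fcf05c88).  2026-09-04.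
-/
import Summits.HodgeConjecture.HodgeConjecture.Theorems.F0P3cDyRamDiagonalKappaCoreHangingClass   -- κH-A2 (LH4-p06 (g3)): `kappaCount_zero_latt_coreHanging_eq` (the per-class κ-count, alive∕dead); brings κH-A1, ★ Fκ1∕Fκ2, ★ (C) `CoreHangingCount`
import Summits.HodgeConjecture.HodgeConjecture.Theorems.F0P3cDyRamDiagonalCoreHangingGlueCount    -- ★ p856200 (D2) (LH4-p07 (g3)): `coreHangingStratum_eq_iUnion_orbits_glue`, `pairwise_disjoint_orbits_of`, `v_one_add_eq_one_of_glue`; brings ★ (D1) `ncard_glue_representatives_eq`, `glue_representatives_eq_empty`, ★ (C) `coreHangingStratum_eq_iUnion_orbits`, `pairwise_disjoint_orbits`, `finsum_stabiliserWeight_orbit_eq`, ★ (A), ★ (iv-c) `exists_fixed_class_representatives`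
import Summits.HodgeConjecture.HodgeConjecture.Theorems.F0P3cDyRamDiagonalKappaCoreHangingCharacterSums -- κH-B1 (LH4-p06 (g3)): (T1) `finsum_chiH_admissible_eq_zero`, (T2a) `finsum_chiH_glue_eq_zero`, (T2b) `finsum_chiH_glue_eq_ncard_mul` (interface letter fcf05c88 §1)
import Summits.HodgeConjecture.HodgeConjecture.Theorems.F0P3cDyRamDiagonalCoreHangingSocket       -- ★ p856251 (E) (LH4-p07 (g3)): `stratum_H_eq`; brings ★ `isoceles_of_isElementDatum`, `le_min_depth_of_isElementDatum`, `exists_fixed_near_glueUnit_iff_le`, `trace_bound_of_isRamifiedQuadraticDatum`, `v_eq_one_of_mul_map_eq_one`, the (D1) empties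
import HarnessLib

/-!
# Crux `H413`, line LH4 «(D-RAM) FOUR-FRAME» road — unit U3_Laws (iii), κ-STAGE B brick κB-H, FILE κH-B2 «THE κ-WEIGHTED COUNT OF THE CORE-HANGING STRATA, ASSEMBLED
# MODULO THE CHARACTER SUMS»: `∑ᶠ_{M ∈ 𝒮_H(ρ)} κ_i(M)·w(M)` orbit by orbit

Cell `hodgecm-mathlib` (D-0151), FLOOR 0, crux item H413 = `stmt-HodgeConjecture-24833`, route of record `HCCMUnconditional`; squad F0∕P3c∕LH4 (req618∕req620).  THEOREMS ONLY
(no `def`, no instance, no notation, no `sorry`, default heartbeats); lane `--supports stmt-HodgeConjecture-24833 --as helper` (count-neutral).  LAW-FREE.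

THE OBJECT (LH4-p05 (g3) PLAN v1 §4 row H; LH4-p06 (g3) LETTER da173de2 §1–§3; LH4-r01 (g3) oracle ER 340∕340).  The κ-twisted census weights each lattice of the core-hanging stratum
`𝒮_H(ρ) = {latt (1 0 0; x ϖ^ρ 0; xζ+y″ ϖ^ρζ ϖ^{2ρ}) : |x| = |ζ| = |y″| = |xζ+y″| = 1, T-stable, dualisable}` (axis `(2ρ, 2ρ, 2ρ)`, `ρ ≥ 1`) by the signed κ-count
`kappaCount σ ϖ 0 i M` (★ Fκ1).  ★ (C)∕(D2) (LH4-p07 (g3)) decompose `𝒮_H(ρ)` into the unit-torus orbits of the representatives `latt V_H(1,1,g)`, `g` running over the ADMISSIBLE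
(`|1+g| = 1`; tube) resp. GLUE (`|g + g₀| ≤ |ϖ|^{2ρ−m}`; equilateral foot) classes of a system `R` of fixed units mod `𝔭^ρ`; κH-A2 (LH4-p06 (g3)) evaluates `kappaCount` on every member
of the orbit of `g`: `[2d−1 ≤ ρ]·χ_i(g)`, `(χ_0, χ_1, χ_2)(g) = (ω(−(1+g)), ω(g)ω(−(1+g)), ω(g))`.  THIS FILE assembles:
* §1 `finsum_kappaCount_mul_stabiliserWeight_orbit_eq` — `∑ᶠ_{M ∈ 𝒯·latt V_H(1,1,g)} κ_i(M)·w(M) = ([2d−1 ≤ ρ]·χ_i(g)) · ‹★ (C) orbit mass›` (κ is orbit-constant BY VALUE: every orbit member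
  is a core-hanging lattice with the EXACT invariant `g`, ★ (A) `exists_coreHanging_of_mem_orbit`).
* §2 TUBE `finsum_kappaCount_mul_stabiliserWeight_coreHangingStratum_tube` — `= 0`: in the alive window the admissible character sum `Σ_{g ∈ R, |1+g| = 1} χ_i(g)` vanishes
  (κH-B1 (T1) `finsum_chiH_admissible_eq_zero`, LETTER §2 «wild cancellation», r01 ER «(0,0,0) for ρ = 1..8»); in the dead window every class contributes `0`.
* §3 GLUE `finsum_kappaCount_mul_stabiliserWeight_coreHangingStratum_glue` — `= [2d−1 ≤ 2ρ−m]·χ_i(f₀)·q^{2ρ−⌈(2ρ−m)∕2⌉}` (κH-B1 (T2a) `finsum_chiH_glue_eq_zero` ∕ (T2b)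
  `finsum_chiH_glue_eq_ncard_mul` on the glue ball, ★ (D1) `ncard_glue_representatives_eq`, the arithmetic of ★ (D2)); `…_glue_eq_zero` when the glue unit is not `F`-rational.
* §4 HEAD **`finsum_kappaCount_mul_stabiliserWeight_hasAxis_H`** — over `stratum σ ϖ T ![2ρ, 2ρ, 2ρ]` under the B10∕Fκ5 binders (`hD`, `h2`, `hE`, `hN₀`, `hT`) plus the glue-witness
  binder `f₀` (LETTER da173de2 §HEAD), regime by regime as ★ (E) `finsum_stabiliserWeight_hasAxis_H` (token for token):
  `= if n₁ = n₂ = n₃ =: m < 2ρ ∧ 2ρ−m ≤ m−d+1 ∧ d ≤ ⌈(2ρ−m)∕2⌉ then χ_i(f₀)·q^{2ρ−⌈(2ρ−m)∕2⌉} else 0` — the TUBE summand is ABSENT: it vanishes (wild cancellation, κH-B1 (T1)).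
The character sums (T1)∕(T2a)∕(T2b) are IMPORTED BY NAME from κH-B1 `…KappaCoreHangingCharacterSums` (LH4-p06 (g3)).
HONEST LABEL.  Count-neutral (`--supports`); (KMS)∕(KSS) stay PROVER TARGETS; `HC_CM` is proved only modulo the
7 printed citations (2 remaining named inputs: hLiu418 = `stmt-HodgeConjecture-24832`, h413 = `stmt-HodgeConjecture-24833`) until rung 0 closes.

## References
* [Kottwitz1986BaseChangeUnits] R. E. Kottwitz, *Base change for unit elements of Hecke algebras*, Compositio Math. 60 (1986), §1 pp. 240–241 (κ-orbital integrals of units as signed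
  lattice counts modulo the torus).
* [LanglandsShelstad1987] R. P. Langlands, D. Shelstad, *On the definition of transfer factors*, Math. Ann. 278 (1987), §3 (κ as a character of `H¹(F, T)`).
* [Rogawski1990] J. D. Rogawski, *Automorphic Representations of Unitary Groups in Three Variables*, Ann. of Math. Stud. 123 (1990), §4.9 Prop. 4.9.1 (a) p. 55.
-/

set_option autoImplicit false

noncomputable section

namespace Summit.HodgeConjecture.HodgeConjecture.Cruxes.H413.F0P3cDyRamDiagonalKappaCoreHangingSocket

open Matrix WithZero
open Literature.NumberTheory.Automorphic Literature.NumberTheory.Automorphic.HermitianLattice Literature.NumberTheory.Automorphic.UnitaryGroup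
open Literature.NumberTheory.Automorphic.UnitaryLatticeTree Literature.NumberTheory.Automorphic.UnitaryThreeFourFrame
open Literature.NumberTheory.LocalFields.WildQuadraticDatum
open Summit.HodgeConjecture.HodgeConjecture.Cruxes.H413.F0P3cDyRamDiagonalTorusDefs
open Summit.HodgeConjecture.HodgeConjecture.Cruxes.H413.F0P3cDyRamDiagonalStrataDefs
open Summit.HodgeConjecture.HodgeConjecture.Cruxes.H413.F0P3cDyRamDiagonalGluedStabiliserIndex
open Summit.HodgeConjecture.HodgeConjecture.Cruxes.H413.F0P3cDyRamDiagonalGluedStabiliserIndexFull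
open Summit.HodgeConjecture.HodgeConjecture.Cruxes.H413.F0P3cDyRamDiagonalGluedTorusOrbits
open Summit.HodgeConjecture.HodgeConjecture.Cruxes.H413.F0P3cDyRamDiagonalGluedClassRepresentatives
open Summit.HodgeConjecture.HodgeConjecture.Cruxes.H413.F0P3cDyRamDiagonalCoreHangingOrbits
open Summit.HodgeConjecture.HodgeConjecture.Cruxes.H413.F0P3cDyRamDiagonalCoreHangingCount
open Summit.HodgeConjecture.HodgeConjecture.Cruxes.H413.F0P3cDyRamDiagonalCoreHangingFoot
open Summit.HodgeConjecture.HodgeConjecture.Cruxes.H413.F0P3cDyRamDiagonalCoreHangingGlueCount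
open Summit.HodgeConjecture.HodgeConjecture.Cruxes.H413.F0P3cDyRamDiagonalCoreHangingSocket
open Summit.HodgeConjecture.HodgeConjecture.Cruxes.H413.F0P3cDyRamElementDatumParity
open Summit.HodgeConjecture.HodgeConjecture.Cruxes.H413.F0P3cDyRamGlueUnitRationalityDepth
open Summit.HodgeConjecture.HodgeConjecture.Cruxes.H413.F0P3cDyRamDiagonalKappaCountDefs
open Summit.HodgeConjecture.HodgeConjecture.Cruxes.H413.F0P3cDyRamDiagonalKappaCoreHangingClass
open Summit.HodgeConjecture.HodgeConjecture.Cruxes.H413.F0P3cDyRamDiagonalKappaCoreHangingCharacterSums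
open scoped Valued WithZero Matrix MatrixGroups

variable {K : Type} [Field K] [Valued K ℤᵐ⁰]

/-! ## §0  Finiteness of the torus orbits -/

/-- The unit-torus orbit of `latt V_H(1,1,g)` (`|g| = 1`, `ρ ≥ 1`) is finite (★ (iv-b-idx) `ncard_unitTorus_orbit_latt_glued_eq` at `s = 0`). [cite: Kottwitz1986BaseChangeUnits, §1 pp. 240–241] -/
theorem finite_orbit [Finite 𝓀[K]] {ϖ : K} (hϖ : Valued.v ϖ = WithZero.exp (-1 : ℤ)) {ρ : ℕ} (hρ : 1 ≤ ρ) {g : K} (hvg : Valued.v g = 1) :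
    {M : Submodule 𝒪[K] (Fin 3 → K) | ∃ u ∈ unitTorus K 3,
      M = mapGL (diagGLUnits u) (latt (!![1, 0, 0; 1, ϖ ^ ρ, 0; 1 * 1 + g, ϖ ^ ρ * 1, ϖ ^ (2 * ρ)] : Matrix (Fin 3) (Fin 3) K))}.Finite := by
  obtain ⟨hϖ0, -⟩ := ne_zero_and_v_lt_one_of_v_eq_exp hϖ
  have hq : 1 < Nat.card 𝓀[K] := Finite.one_lt_card
  obtain ⟨V₀, hV₀⟩ := exists_gl_coe_eq_glued (1 : K) 1 g (pow_ne_zero ρ hϖ0) (pow_ne_zero (2 * ρ) hϖ0)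
  have hV0 : (V₀ : Matrix (Fin 3) (Fin 3) K) = !![1, 0, 0; 1, ϖ ^ ρ, 0; 1 * 1 + g, ϖ ^ ρ * 1, ϖ ^ (2 * ρ + 0)] := by rw [Nat.add_zero]; exact hV₀
  have hcard := ncard_unitTorus_orbit_latt_glued_eq hϖ hρ 0 (map_one _) (map_one _) (by rw [pow_zero]; exact hvg) V₀ hV0
  rw [← hV₀]
  refine Set.finite_of_ncard_ne_zero ?_
  rw [hcard]
  exact mul_ne_zero (mul_ne_zero (by omega) (pow_ne_zero _ (by omega))) (mul_ne_zero (by omega) (pow_ne_zero _ (by omega)))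

/-! ## §1  One orbit: the κ-count is constant by value along `𝒯·latt V_H(1,1,g)` -/

/-- **THE κ-WEIGHTED MASS OF ONE ORBIT**: for a fixed unit `g` with `|1 + g| = 1`, every member of the unit-torus orbit `𝒯·latt V_H(1,1,g)` is a core-hanging lattice
`latt (1 0 0; x ϖ^ρ 0; xζ + g·xζ ϖ^ρζ ϖ^{2ρ})` with the EXACT invariant `g` (★ (A) `exists_coreHanging_of_mem_orbit`), so κH-A2 gives `kappaCount σ ϖ 0 i M = [2d−1 ≤ ρ]·χ_i(g)` on the whole
orbit, and `∑ᶠ_{orbit} κ_i·w = ([2d−1 ≤ ρ]·χ_i(g)) · ∑ᶠ_{orbit} w`, the second factor being ★ (C) `finsum_stabiliserWeight_orbit_eq`. [cite: Kottwitz1986BaseChangeUnits, §1 pp. 240–241] [cite: LanglandsShelstad1987, §3] -/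
theorem finsum_kappaCount_mul_stabiliserWeight_orbit_eq [CompleteSpace K] [Finite 𝓀[K]] {σ : K →+* K} {ϖ : K} {d t : ℕ}
    (hD : IsRamifiedQuadraticDatum σ ϖ d t) (h2 : Valued.v (2 : K) < 1) {ρ : ℕ} (hρ : 1 ≤ ρ) {g : K} (hσg : σ g = g) (hvg : Valued.v g = 1) (h1g : Valued.v (1 + g) = 1) (i : Fin 3) :
    ∑ᶠ M ∈ {M : Submodule 𝒪[K] (Fin 3 → K) | ∃ u ∈ unitTorus K 3, M = mapGL (diagGLUnits u) (latt (!![1, 0, 0; 1, ϖ ^ ρ, 0; 1 * 1 + g, ϖ ^ ρ * 1, ϖ ^ (2 * ρ)] : Matrix (Fin 3) (Fin 3) K))},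
        (kappaCount σ ϖ 0 i M : ℚ) * stabiliserWeight σ M =
      (((if 2 * d - 1 ≤ ρ then (![normSign σ (-(1 + g)), normSign σ g * normSign σ (-(1 + g)), normSign σ g] : Fin 3 → ℤ) i else 0) : ℤ) : ℚ) *
        (((((Nat.card 𝓀[K] - 1) * Nat.card 𝓀[K] ^ (ρ - 1)) * ((Nat.card 𝓀[K] - 1) * Nat.card 𝓀[K] ^ (2 * ρ - 1)) : ℕ) : ℚ) *
          ((((Nat.card 𝓀[K] - 1) * Nat.card 𝓀[K] ^ ((ρ + 1) / 2 - 1)) * ((Nat.card 𝓀[K] - 1) * Nat.card 𝓀[K] ^ (ρ - 1)) : ℕ) : ℚ)⁻¹) := by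
  have hTr := trace_bound_of_isRamifiedQuadraticDatum hD h2
  obtain ⟨hσ, hvσ, hϖ, hfix, hd, -, -⟩ := id hD
  obtain ⟨hϖ0, -⟩ := ne_zero_and_v_lt_one_of_v_eq_exp hϖ
  -- κ is constant on the orbit, by value
  have hconst : ∀ M ∈ {M : Submodule 𝒪[K] (Fin 3 → K) | ∃ u ∈ unitTorus K 3,
        M = mapGL (diagGLUnits u) (latt (!![1, 0, 0; 1, ϖ ^ ρ, 0; 1 * 1 + g, ϖ ^ ρ * 1, ϖ ^ (2 * ρ)] : Matrix (Fin 3) (Fin 3) K))},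
      (kappaCount σ ϖ 0 i M : ℚ) =
        (((if 2 * d - 1 ≤ ρ then (![normSign σ (-(1 + g)), normSign σ g * normSign σ (-(1 + g)), normSign σ g] : Fin 3 → ℤ) i else 0) : ℤ) : ℚ) := by
    rintro M ⟨u, hu, rfl⟩
    obtain ⟨V₀, hV₀⟩ := exists_gl_coe_eq_glued (1 : K) 1 g (pow_ne_zero ρ hϖ0) (pow_ne_zero (2 * ρ) hϖ0)
    obtain ⟨x', ζ', y₁, hx', hζ', -, -, hκ, hM⟩ := exists_coreHanging_of_mem_orbit u hu hvg h1g (ϖ ^ ρ) (ϖ ^ (2 * ρ)) V₀ hV₀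
    have hx0 : x' ≠ 0 := fun h0 => by rw [h0, map_zero] at hx'; exact zero_ne_one hx'
    have hζ0 : ζ' ≠ 0 := fun h0 => by rw [h0, map_zero] at hζ'; exact zero_ne_one hζ'
    have hy₁ : y₁ = g * (x' * ζ') := by rw [← hκ]; field_simp
    obtain ⟨V, hV⟩ := exists_gl_coe_eq_glued x' ζ' (g * (x' * ζ')) (pow_ne_zero ρ hϖ0) (pow_ne_zero (2 * ρ) hϖ0)
    rw [← hV₀, hM, hy₁, ← hV, kappaCount_zero_latt_coreHanging_eq hD h2 hTr hρ hx' hζ' hσg hvg h1g V hV i]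
  rw [← finsum_stabiliserWeight_orbit_eq hσ hvσ hfix hϖ hd hρ hσg hvg, mul_finsum_mem]
  exact finsum_mem_congr rfl fun M hM => by rw [hconst M hM]

/-! ## §2  TUBE regime: the κ-weighted count vanishes -/

/-- **TUBE REGIME (`2ρ ≤ n₁, n₂`, `ρ ≤ n₃`): `∑ᶠ_{M ∈ 𝒮_H(ρ)} κ_i(M)·w(M) = 0`.**  Orbit by orbit over the admissible classes (★ (C)): `Σ_{g ∈ R, |1+g| = 1} c_i(g)·mass`; in the alive
window `2d−1 ≤ ρ` this is `mass · Σ χ^H_i(g) = 0` by κH-B1 (T1) (ω is a NON-trivial character on `U_F∕U_F(ρ)` and on `U_{F,1}∕U_F(ρ)` — the wild fence `|2| < 1` makes its conductor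
`≥ 2`); in the dead window every `c_i(g) = 0`.  (TAME contrast: with `d = 1` the tube would NOT cancel.) [cite: Kottwitz1986BaseChangeUnits, §1 pp. 240–241] [cite: LanglandsShelstad1987, §3] -/
theorem finsum_kappaCount_mul_stabiliserWeight_coreHangingStratum_tube [CompleteSpace K] [Finite 𝓀[K]] {σ : K →+* K} {ϖ : K} {d t : ℕ}
    (hD : IsRamifiedQuadraticDatum σ ϖ d t) (h2 : Valued.v (2 : K) < 1)
    (T : GL (Fin 3) K) {α β : K} (hT : (T : Matrix (Fin 3) (Fin 3) K) = Matrix.diagonal ![α, β, 1]) (hα : Valued.v α = 1) (hβ : Valued.v β = 1)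
    {n₁ n₂ n₃ : ℕ} (h₁ : Valued.v (β - 1) = Valued.v ϖ ^ n₁) (h₂ : Valued.v (α - 1) = Valued.v ϖ ^ n₂) (h₃ : Valued.v (β - α) = Valued.v ϖ ^ n₃)
    {ρ : ℕ} (hρ : 1 ≤ ρ) (hρ₁ : 2 * ρ ≤ n₁) (hρ₂ : 2 * ρ ≤ n₂) (hρ₃ : ρ ≤ n₃) (i : Fin 3) :
    ∑ᶠ M ∈ {M : Submodule 𝒪[K] (Fin 3 → K) | M ∈ normalisedStableLattices T ∧ IsDualisableLattice σ ϖ M ∧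
        ∃ x ζ y'' : K, Valued.v x = 1 ∧ Valued.v ζ = 1 ∧ Valued.v y'' = 1 ∧ Valued.v (x * ζ + y'') = 1 ∧
          M = latt (!![1, 0, 0; x, ϖ ^ ρ, 0; x * ζ + y'', ϖ ^ ρ * ζ, ϖ ^ (2 * ρ)] : Matrix (Fin 3) (Fin 3) K)},
        (kappaCount σ ϖ 0 i M : ℚ) * stabiliserWeight σ M = 0 := by
  have hTr := trace_bound_of_isRamifiedQuadraticDatum hD h2
  obtain ⟨hσ, hvσ, hϖ, hfix, hd, -, -⟩ := id hD
  -- representatives of the fixed units mod `𝔭^ρ` (★ (iv-c) at `t = 0`)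
  obtain ⟨R, hRfin, hRcard, hR1, hR2, hR3⟩ := exists_fixed_class_representatives hσ hvσ hfix hϖ hd ρ 0 hρ
  simp only [Nat.mul_zero, pow_zero, Nat.add_zero] at hR1 hR2 hR3
  have hRadmfin : {g : K | g ∈ R ∧ Valued.v (1 + g) = 1}.Finite := hRfin.subset (Set.sep_subset _ _)
  -- decompose and sum orbit by orbit
  rw [coreHangingStratum_eq_iUnion_orbits hσ hvσ hϖ hTr T hT hα hβ h₁ h₂ h₃ hρ hρ₁ hρ₂ hρ₃ hR1 hR2,
    finsum_mem_biUnion (pairwise_disjoint_orbits hϖ ρ (fun g hg => (hR1 g hg).2) hR3) hRadmfin (fun g hg => finite_orbit hϖ hρ (hR1 _ hg.1).2),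
    finsum_mem_congr rfl (fun g hg => finsum_kappaCount_mul_stabiliserWeight_orbit_eq hD h2 hρ (hR1 _ hg.1).1 (hR1 _ hg.1).2 hg.2 i),
    ← finsum_mem_mul]
  by_cases halive : 2 * d - 1 ≤ ρ
  · simp only [if_pos halive]
    rw [finsum_chiH_admissible_eq_zero hD h2 halive hRfin hR1 hR2 hR3 i, zero_mul]
  · simp only [if_neg halive, Int.cast_zero]
    rw [show (∑ᶠ g ∈ {g : K | g ∈ R ∧ Valued.v (1 + g) = 1}, (0 : ℚ)) = 0 by simp, zero_mul]

/-! ## §3  EQUILATERAL GLUE regime -/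

/-- The glue unit `g₀ = (β−1)∕(α−1)` of an equilateral key (`|β−1| = |α−1| = |β−α| = |ϖ|^m`) is a unit with `|1 − g₀| = 1`. [cite: Kottwitz1986BaseChangeUnits, §1 pp. 240–241] -/
theorem v_glueUnit_letters {ϖ : K} (hϖ0 : ϖ ≠ 0) {α β : K} {m : ℕ}
    (h₁ : Valued.v (β - 1) = Valued.v ϖ ^ m) (h₂ : Valued.v (α - 1) = Valued.v ϖ ^ m) (h₃ : Valued.v (β - α) = Valued.v ϖ ^ m) :
    Valued.v ((β - 1) / (α - 1)) = 1 ∧ Valued.v (1 - (β - 1) / (α - 1)) = 1 := by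
  have hvϖ : 0 < Valued.v ϖ := (Valuation.pos_iff _).2 hϖ0
  have hm0 : Valued.v ϖ ^ m ≠ 0 := pow_ne_zero _ hvϖ.ne'
  have hα1 : α - 1 ≠ 0 := fun h0 => by rw [h0, map_zero] at h₂; exact hm0 h₂.symm
  refine ⟨by rw [map_div₀, h₁, h₂, div_self hm0], ?_⟩
  rw [show 1 - (β - 1) / (α - 1) = -(β - α) / (α - 1) by field_simp; ring, map_div₀, Valuation.map_neg, h₃, h₂, div_self hm0]

/-- **EQUILATERAL GLUE (`n₁ = n₂ = n₃ = m`, `ρ ≤ m < 2ρ`, glue unit `F`-rational to depth `e = 2ρ − m` with witness `f₀`):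
`∑ᶠ_{M ∈ 𝒮_H(ρ)} κ_i(M)·w(M) = [2d−1 ≤ e] · χ^H_i(f₀) · q^{2ρ−⌈e∕2⌉}`.**  Orbit by orbit over the glue ball `R_glue = {g ∈ R : |g + g₀| ≤ |ϖ|^e}` (★ (D2)):
`Σ_{g ∈ R_glue} c_i(g)·mass`; dead window (`ρ < 2d−1`): all `c_i = 0`; alive but `e ≤ 2d−2`: `mass·Σ χ^H_i = 0` (κH-B1 (T2a)); `2d−1 ≤ e`: `Σ χ^H_i = #R_glue·χ^H_i(f₀)`
(κH-B1 (T2b)) and `#R_glue·mass = q^{⌈ρ∕2⌉−⌈e∕2⌉}·q^{2ρ−⌈ρ∕2⌉}` (★ (D1), ★ (C)). [cite: Kottwitz1986BaseChangeUnits, §1 pp. 240–241] [cite: LanglandsShelstad1987, §3] [cite: Rogawski1990, §4.9 Prop. 4.9.1 (a) p. 55] -/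
theorem finsum_kappaCount_mul_stabiliserWeight_coreHangingStratum_glue [CompleteSpace K] [Finite 𝓀[K]] {σ : K →+* K} {ϖ : K} {d t : ℕ}
    (hD : IsRamifiedQuadraticDatum σ ϖ d t) (h2 : Valued.v (2 : K) < 1)
    (T : GL (Fin 3) K) {α β : K} (hT : (T : Matrix (Fin 3) (Fin 3) K) = Matrix.diagonal ![α, β, 1]) (hα : Valued.v α = 1) (hβ : Valued.v β = 1)
    {m : ℕ} (h₁ : Valued.v (β - 1) = Valued.v ϖ ^ m) (h₂ : Valued.v (α - 1) = Valued.v ϖ ^ m) (h₃ : Valued.v (β - α) = Valued.v ϖ ^ m)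
    {ρ : ℕ} (hρ : 1 ≤ ρ) (hρm : ρ ≤ m) (hm : m < 2 * ρ)
    {f₀ : K} (hσf₀ : σ f₀ = f₀) (hf₀ : Valued.v (f₀ + (β - 1) / (α - 1)) ≤ Valued.v ϖ ^ (2 * ρ - m)) (i : Fin 3) :
    ∑ᶠ M ∈ {M : Submodule 𝒪[K] (Fin 3 → K) | M ∈ normalisedStableLattices T ∧ IsDualisableLattice σ ϖ M ∧
        ∃ x ζ y'' : K, Valued.v x = 1 ∧ Valued.v ζ = 1 ∧ Valued.v y'' = 1 ∧ Valued.v (x * ζ + y'') = 1 ∧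
          M = latt (!![1, 0, 0; x, ϖ ^ ρ, 0; x * ζ + y'', ϖ ^ ρ * ζ, ϖ ^ (2 * ρ)] : Matrix (Fin 3) (Fin 3) K)},
        (kappaCount σ ϖ 0 i M : ℚ) * stabiliserWeight σ M =
      if 2 * d - 1 ≤ 2 * ρ - m then
        (((![normSign σ (-(1 + f₀)), normSign σ f₀ * normSign σ (-(1 + f₀)), normSign σ f₀] : Fin 3 → ℤ) i : ℤ) : ℚ) *
          (Nat.card 𝓀[K] : ℚ) ^ (2 * ρ - (2 * ρ - m + 1) / 2)
      else 0 := by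
  have hTr := trace_bound_of_isRamifiedQuadraticDatum hD h2
  obtain ⟨hσ, hvσ, hϖ, hfix, hd, -, -⟩ := id hD
  obtain ⟨hϖ0, hϖ1⟩ := ne_zero_and_v_lt_one_of_v_eq_exp hϖ
  have hq : 1 < Nat.card 𝓀[K] := Finite.one_lt_card
  have he1 : 1 ≤ 2 * ρ - m := by omega
  have heρ : 2 * ρ - m ≤ ρ := by omega
  obtain ⟨hg₀, h1g₀⟩ := v_glueUnit_letters hϖ0 h₁ h₂ h₃
  -- representatives and the glue ball
  obtain ⟨R, hRfin, -, hR1, hR2, hR3⟩ := exists_fixed_class_representatives hσ hvσ hfix hϖ hd ρ 0 hρ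
  simp only [Nat.mul_zero, pow_zero, Nat.add_zero] at hR1 hR2 hR3
  have hglue := ncard_glue_representatives_eq hσ hvσ hfix hϖ hd he1 heρ hRfin hR1 hR2 hR3 hg₀ hσf₀ hf₀
  have hRgfin : {g : K | g ∈ R ∧ Valued.v (g + (β - 1) / (α - 1)) ≤ Valued.v ϖ ^ (2 * ρ - m)}.Finite := hRfin.subset (Set.sep_subset _ _)
  rw [coreHangingStratum_eq_iUnion_orbits_glue hσ hvσ hϖ hTr T hT hα hβ h₁ h₂ h₃ hρ hρm hm hR1 hR2,
    finsum_mem_biUnion (pairwise_disjoint_orbits_of hϖ ρ (Set.sep_subset _ _) (fun g hg => (hR1 g hg).2)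
      (fun g hg => v_one_add_eq_one_of_glue hϖ h₂ h₃ he1 hg.2) hR3) hRgfin (fun g hg => finite_orbit hϖ hρ (hR1 _ hg.1).2),
    finsum_mem_congr rfl (fun g hg => finsum_kappaCount_mul_stabiliserWeight_orbit_eq hD h2 hρ (hR1 _ hg.1).1 (hR1 _ hg.1).2
      (v_one_add_eq_one_of_glue hϖ h₂ h₃ he1 hg.2) i),
    ← finsum_mem_mul]
  by_cases halive : 2 * d - 1 ≤ ρ
  · simp only [if_pos halive]
    by_cases he : 2 * d - 1 ≤ 2 * ρ - m
    · -- ω is TRIVIAL on the glue ball: every class carries `χ^H_i(f₀)`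
      rw [if_pos he, finsum_chiH_glue_eq_ncard_mul hD hRfin hR1 hg₀ h1g₀ he hσf₀ hf₀ i, hglue]
      -- arithmetic (★ (D2) verbatim): `q^{a−b}·χ·mass = χ·q^{2ρ−b}`, `a = ⌈ρ∕2⌉`, `b = ⌈e∕2⌉`
      have hq1 : ((Nat.card 𝓀[K] : ℚ) - 1) ≠ 0 := by
        have : (1 : ℚ) < Nat.card 𝓀[K] := by exact_mod_cast hq
        linarith
      have hq0 : (Nat.card 𝓀[K] : ℚ) ≠ 0 := by exact_mod_cast (by omega : Nat.card 𝓀[K] ≠ 0)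
      have hden : ((((Nat.card 𝓀[K] - 1) * Nat.card 𝓀[K] ^ ((ρ + 1) / 2 - 1)) * ((Nat.card 𝓀[K] - 1) * Nat.card 𝓀[K] ^ (ρ - 1)) : ℕ) : ℚ) ≠ 0 := by
        push_cast [Nat.cast_sub hq.le]
        exact mul_ne_zero (mul_ne_zero hq1 (pow_ne_zero _ hq0)) (mul_ne_zero hq1 (pow_ne_zero _ hq0))
      have key : (Nat.card 𝓀[K] : ℚ) ^ ((ρ + 1) / 2 - (2 * ρ - m + 1) / 2) * (Nat.card 𝓀[K] : ℚ) ^ (ρ - 1) * (Nat.card 𝓀[K] : ℚ) ^ (2 * ρ - 1) =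
          (Nat.card 𝓀[K] : ℚ) ^ (2 * ρ - (2 * ρ - m + 1) / 2) * (Nat.card 𝓀[K] : ℚ) ^ ((ρ + 1) / 2 - 1) * (Nat.card 𝓀[K] : ℚ) ^ (ρ - 1) := by
        rw [← pow_add, ← pow_add, ← pow_add, ← pow_add]
        congr 1
        omega
      have hmass : ((Nat.card 𝓀[K] ^ ((ρ + 1) / 2 - (2 * ρ - m + 1) / 2) : ℕ) : ℚ) *
          (((((Nat.card 𝓀[K] - 1) * Nat.card 𝓀[K] ^ (ρ - 1)) * ((Nat.card 𝓀[K] - 1) * Nat.card 𝓀[K] ^ (2 * ρ - 1)) : ℕ) : ℚ) *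
            ((((Nat.card 𝓀[K] - 1) * Nat.card 𝓀[K] ^ ((ρ + 1) / 2 - 1)) * ((Nat.card 𝓀[K] - 1) * Nat.card 𝓀[K] ^ (ρ - 1)) : ℕ) : ℚ)⁻¹) =
          (Nat.card 𝓀[K] : ℚ) ^ (2 * ρ - (2 * ρ - m + 1) / 2) := by
        rw [← mul_assoc, mul_inv_eq_iff_eq_mul₀ hden]
        push_cast [Nat.cast_sub hq.le]
        linear_combination ((Nat.card 𝓀[K] : ℚ) - 1) ^ 2 * key
      rw [show ∀ A χ M : ℚ, A * χ * M = χ * (A * M) from fun A χ M => by ring, hmass]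
    · -- ω NON-trivial on the glue ball: cancellation (κH-B1 (T2a))
      rw [if_neg he, finsum_chiH_glue_eq_zero hD h2 halive hRfin hR1 hR2 hR3 hg₀ h1g₀ he1 heρ (by omega) i, zero_mul]
  · simp only [if_neg halive, Int.cast_zero]
    rw [if_neg (by omega), show (∑ᶠ g ∈ {g : K | g ∈ R ∧ Valued.v (g + (β - 1) / (α - 1)) ≤ Valued.v ϖ ^ (2 * ρ - m)}, (0 : ℚ)) = 0 by simp, zero_mul]

/-- **EQUILATERAL GLUE, glue unit NOT `F`-rational to depth `2ρ − m`: the κ-weighted count is `0`** (no orbit qualifies; ★ (D2) twin). [cite: Kottwitz1986BaseChangeUnits, §1 pp. 240–241] -/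
theorem finsum_kappaCount_mul_stabiliserWeight_coreHangingStratum_glue_eq_zero {σ : K →+* K} (hσ : ∀ a, σ (σ a) = a) (hvσ : ∀ a, Valued.v (σ a) = Valued.v a)
    (hfix : ∀ x : K, σ x = x → x ≠ 0 → ∃ n : ℤ, Valued.v x = exp (2 * n)) {ϖ : K} (hϖ : Valued.v ϖ = exp (-1 : ℤ))
    {d : ℕ} (hd : Valued.v (ϖ - σ ϖ) = Valued.v ϖ ^ d) (hTr : ∀ a : K, Valued.v (a + σ a) ≤ Valued.v ϖ * Valued.v a) [Finite 𝓀[K]]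
    (T : GL (Fin 3) K) {α β : K} (hT : (T : Matrix (Fin 3) (Fin 3) K) = Matrix.diagonal ![α, β, 1]) (hα : Valued.v α = 1) (hβ : Valued.v β = 1)
    {m : ℕ} (h₁ : Valued.v (β - 1) = Valued.v ϖ ^ m) (h₂ : Valued.v (α - 1) = Valued.v ϖ ^ m) (h₃ : Valued.v (β - α) = Valued.v ϖ ^ m)
    {ρ : ℕ} (hρ : 1 ≤ ρ) (hρm : ρ ≤ m) (hm : m < 2 * ρ)
    (hno : ¬ ∃ f : K, σ f = f ∧ Valued.v (f + (β - 1) / (α - 1)) ≤ Valued.v ϖ ^ (2 * ρ - m)) (i : Fin 3) :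
    ∑ᶠ M ∈ {M : Submodule 𝒪[K] (Fin 3 → K) | M ∈ normalisedStableLattices T ∧ IsDualisableLattice σ ϖ M ∧
        ∃ x ζ y'' : K, Valued.v x = 1 ∧ Valued.v ζ = 1 ∧ Valued.v y'' = 1 ∧ Valued.v (x * ζ + y'') = 1 ∧
          M = latt (!![1, 0, 0; x, ϖ ^ ρ, 0; x * ζ + y'', ϖ ^ ρ * ζ, ϖ ^ (2 * ρ)] : Matrix (Fin 3) (Fin 3) K)},
        (kappaCount σ ϖ 0 i M : ℚ) * stabiliserWeight σ M = 0 := by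
  obtain ⟨R, -, -, hR1, hR2, -⟩ := exists_fixed_class_representatives hσ hvσ hfix hϖ hd ρ 0 hρ
  simp only [Nat.mul_zero, pow_zero, Nat.add_zero] at hR1 hR2
  rw [coreHangingStratum_eq_iUnion_orbits_glue hσ hvσ hϖ hTr T hT hα hβ h₁ h₂ h₃ hρ hρm hm hR1 hR2,
    show {g : K | g ∈ R ∧ Valued.v (g + (β - 1) / (α - 1)) ≤ Valued.v ϖ ^ (2 * ρ - m)} = ∅ from glue_representatives_eq_empty hR1 hno]
  simp

/-! ## §4  HEAD — the κ-socket on the core-hanging strata -/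

section Socket

variable [CompleteSpace K] [Fintype 𝓀[K]] {σ : K →+* K} {ϖ : K} {d t : ℕ} {α β : K} {N₀ n₁ n₂ n₃ : ℕ} {T : GL (Fin 3) K}

/-- **κB-H · THE κ-SOCKET ON THE CORE-HANGING STRATUM `H(2ρ)` (tv = 0)** (LETTER da173de2 §HEAD; LH4-p05 (g3) PLAN v1 §4 row H): under the B10∕Fκ5 binders, with the
glue-witness binder `f₀` (guarded by the equilateral glue hypotheses, as ★ B0 `exists_fixed_near_glueUnit_iff_le` produces it):
`∑ᶠ_{M ∈ stratum (2ρ,2ρ,2ρ)} κ_i(M)·w(M) = [n₁ = n₂ = n₃ =: m < 2ρ, 2ρ−m ≤ m−d+1, d ≤ ⌈(2ρ−m)∕2⌉] · χ^H_i(f₀) · q^{2ρ−⌈(2ρ−m)∕2⌉}` — the TUBE summand of the stable twin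
★ `finsum_stabiliserWeight_hasAxis_H` is GONE (wild cancellation), and the equilateral glue survives exactly in the window where ω is trivial on the glue ball, signed by
`χ^H_i(f₀) = (ω(−(1+f₀)), ω(f₀)ω(−(1+f₀)), ω(f₀))_i` — the ω-classes of the germs of `(α−β)∕(α−1)`, `(1−β)(α−β)∕(α−1)²`, `(1−β)∕(α−1)` (LETTER §3 dictionary).  Case tree = ★ (E) token for token.
[cite: Rogawski1990, §4.9 Prop. 4.9.1 (a) p. 55] [cite: Kottwitz1986BaseChangeUnits, §1 pp. 240–241] [cite: LanglandsShelstad1987, §3] -/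
theorem finsum_kappaCount_mul_stabiliserWeight_hasAxis_H (hD : IsRamifiedQuadraticDatum σ ϖ d t) (h2 : Valued.v (2 : K) < 1)
    (hE : IsElementDatum σ ϖ N₀ α β n₁ n₂ n₃) (hN₀ : d ≤ N₀) (hT : (T : Matrix (Fin 3) (Fin 3) K) = Matrix.diagonal ![α, β, 1]) (ρ : ℕ) (hρ : 1 ≤ ρ) (i : Fin 3)
    (f₀ : K) (hσf₀ : σ f₀ = f₀) (hf₀ : n₁ = n₂ → n₂ = n₃ → n₁ < 2 * ρ → 2 * ρ - n₁ ≤ n₁ - d + 1 → Valued.v (f₀ + (β - 1) / (α - 1)) ≤ Valued.v ϖ ^ (2 * ρ - n₁)) :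
    ∑ᶠ M ∈ stratum σ ϖ T ![2 * ρ, 2 * ρ, 2 * ρ], (kappaCount σ ϖ 0 i M : ℚ) * stabiliserWeight σ M =
      if n₁ = n₂ ∧ n₂ = n₃ ∧ n₁ < 2 * ρ ∧ 2 * ρ - n₁ ≤ n₁ - d + 1 ∧ d ≤ (2 * ρ - n₁ + 1) / 2
      then (((![normSign σ (-(1 + f₀)), normSign σ f₀ * normSign σ (-(1 + f₀)), normSign σ f₀] : Fin 3 → ℤ) i : ℤ) : ℚ) *
             (Fintype.card 𝓀[K] : ℚ) ^ (2 * ρ - (2 * ρ - n₁ + 1) / 2)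
      else 0 := by
  have hTr := trace_bound_of_isRamifiedQuadraticDatum hD h2
  have hiso := isoceles_of_isElementDatum hD hE
  have hdmin := le_min_depth_of_isElementDatum hE hN₀
  obtain ⟨hσ, hvσ, hϖ, hfix, hd, hd1, -⟩ := id hD
  obtain ⟨hα1, hβ1, -, hαne, hβne, h₁, h₂, h₃, hN₁, hN₂, hN₃⟩ := hE
  have hα : Valued.v α = 1 := UnitaryLatticeTree.v_eq_one_of_mul_map_eq_one hvσ hα1
  have hβ : Valued.v β = 1 := UnitaryLatticeTree.v_eq_one_of_mul_map_eq_one hvσ hβ1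
  have h₃' : Valued.v (β - α) = Valued.v ϖ ^ n₃ := by rw [Valuation.map_sub_swap]; exact h₃
  have hcard : (Nat.card 𝓀[K] : ℚ) = Fintype.card 𝓀[K] := by rw [Nat.card_eq_fintype_card]
  rw [stratum_H_eq hvσ hfix hϖ T hρ]
  by_cases htube : 2 * ρ ≤ min n₁ (min n₂ n₃)
  · -- the tube: wild cancellation
    rw [if_neg (by omega),
      finsum_kappaCount_mul_stabiliserWeight_coreHangingStratum_tube hD h2 T hT hα hβ h₁ h₂ h₃' hρ (by omega) (by omega) (by omega) i]
  · by_cases h12 : n₁ = n₂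
    · -- the foot `n₁ = n₂ = m`
      subst h12
      by_cases hρm : ρ ≤ n₁
      · by_cases h13 : n₁ = n₃
        · -- EQUILATERAL: `m < 2ρ` from `¬htube`
          subst h13
          have hm : n₁ < 2 * ρ := by omega
          have hαd : Valued.v (α - 1) ≤ Valued.v ϖ ^ d := by
            rw [h₂, v_varpi_pow hϖ, v_varpi_pow hϖ, WithZero.exp_le_exp]; omega
          have hβd : Valued.v (β - 1) ≤ Valued.v ϖ ^ d := by
            rw [h₁, v_varpi_pow hϖ, v_varpi_pow hϖ, WithZero.exp_le_exp]; omega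
          have hg₀ : Valued.v ((β - 1) / (α - 1)) = 1 := by
            have hvϖ : 0 < Valued.v ϖ := (Valuation.pos_iff _).2 ((Valuation.ne_zero_iff Valued.v).1 (by rw [hϖ]; exact WithZero.exp_ne_zero))
            rw [map_div₀, h₁, h₂, div_self (pow_ne_zero _ hvϖ.ne')]
          have hswitch := exists_fixed_near_glueUnit_iff_le hσ hvσ hfix hϖ hd hd1 hα1 hβ1 hαne hβne hαd hβd h₃ (by omega) (2 * ρ - n₁)
          rw [hg₀, one_mul] at hswitch
          by_cases hsw : 2 * ρ - n₁ ≤ n₁ - d + 1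
          · rw [finsum_kappaCount_mul_stabiliserWeight_coreHangingStratum_glue hD h2 T hT hα hβ h₁ h₂ h₃' hρ hρm hm hσf₀ (hf₀ rfl rfl hm hsw) i, hcard]
            by_cases he : 2 * d - 1 ≤ 2 * ρ - n₁
            · rw [if_pos he, if_pos ⟨rfl, rfl, hm, hsw, by omega⟩]
            · rw [if_neg he, if_neg (by rintro ⟨-, -, -, -, h⟩; omega)]
          · rw [if_neg (by rintro ⟨-, -, -, h, -⟩; exact hsw h)]
            refine finsum_kappaCount_mul_stabiliserWeight_coreHangingStratum_glue_eq_zero hσ hvσ hfix hϖ hd hTr T hT hα hβ h₁ h₂ h₃' hρ hρm hm ?_ i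
            rintro ⟨f, hσf, hf⟩
            exact hsw (hswitch.1 ⟨-f, by rw [map_neg, hσf], by rw [show (β - 1) / (α - 1) - -f = f + (β - 1) / (α - 1) by ring]; exact hf⟩)
        · -- `n₃ ≠ m`: then `m < 2ρ` (isoceles) and the stratum is empty
          have hm : n₁ < 2 * ρ := by
            rcases hiso with ⟨-, h13'⟩ | ⟨h, -⟩ | ⟨h, -⟩ <;> omega
          rw [if_neg (by rintro ⟨-, h, -⟩; exact h13 h),
            coreHangingStratum_eq_empty_of_ne₃ σ hϖ T hT hα hβ h₁ h₂ h₃' hm (Ne.symm h13), finsum_mem_empty]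
      · -- `m < ρ`: (S1) fails
        rw [not_le] at hρm
        rw [if_neg (by omega), coreHangingStratum_eq_empty_of_lt_rho σ hϖ T hT hα hβ h₁ h₂ h₃' hρm, finsum_mem_empty]
    · -- off the foot, below the tube: empty
      have hlow : ¬ (2 * ρ ≤ n₁ ∧ 2 * ρ ≤ n₂) := by
        rintro ⟨ha, hb⟩
        rcases hiso with ⟨h, -⟩ | ⟨h, -⟩ | ⟨h, -⟩ <;> omega
      rw [if_neg (by rintro ⟨h, -⟩; exact h12 h), coreHangingStratum_eq_empty_of_ne σ hϖ T hT hα hβ h₁ h₂ h12 hlow, finsum_mem_empty]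

end Socket

end Summit.HodgeConjecture.HodgeConjecture.Cruxes.H413.F0P3cDyRamDiagonalKappaCoreHangingSocket

end
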